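import Literature.AlgebraicGeometry.ProjectiveGeometry.AmpleLocusOpenAffine
import HarnessLib

/-!
# The very-ample locus is open (cf. [EGAIII1] Thm. 4.7.1, [GortzWedhorn2023] Thm. 24.46): a fibre embedded by its own sections of a line
# bundle `E`, with `H¹`-type vanishing there, has an open neighbourhood over which EVERY fibre is embedded by its own sections of `E`

Topic `AlgebraicGeometry/ProjectiveGeometry`; namespace `Literature.AlgebraicGeometry.Morphisms`.  THEOREMS ONLY (no definition, no named
fact, no instance, no notation, no `sorry`); universe `Scheme.{0}` (the universe of the tree's cohomology-and-base-change bricks).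
Cell `hodgecm-mathlib` (D-0151), P6 «MOD programme», organ «AmpleLocusOpen» (LEAD F0P6-plan (g2) RULING 2026-09-01 22:00:28Z / 22:26:05Z;
B-p10 (g29)); consumers: the abelian-scheme ample locus (`AbelianSchemes/AbelianSchemeAmpleLocusOpen`, for ★ `PolarizationSpreadStage` §3
`hopen`), E6-Π.  Count-neutral: HC_CM is proved only modulo the printed citations until rung 0 closes — nothing here bears on a summit.

THE PRINT.  [EGAIII1] Thm. (4.7.1) (p. 145): «`Y` localement noethérien, `f : X → Y` PROPRE, `ℒ` inversible, `ℒ_y` ample sur `X_y`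
⇒ un voisinage ouvert `U ∋ y` tel que `ℒ|f⁻¹(U)` soit ample pour `f⁻¹(U) → U`» (= [GortzWedhorn2023] Thm. 24.46, [StacksProject] Tag 0D2N).
WHAT IS PROVED — a special case with a DIFFERENT SPINE (flat + `H¹`, Mumford §5, instead of EGA's 𝔪-adic argument), in the tree's
very-ample currency (★ `Motives/GeneratingSectionsOfLineBundle`: a rank-one FRAMED module `E`, finitely many sections, the morphism
`toProj` to `ℙⁿ` they define; no module-level «ample» predicate exists in the tree and none is introduced):
**`exists_opens_forall_fibre_isClosedImmersion_toProj`** — for `f : X → T` PROPER and FLAT over a LOCALLY NOETHERIAN `T` and `x ∈ T`, if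
over ONE field-valued point `Spec K → T` centred at `x` (e.g. a geometric point) the fibre `X₁` (any cartesian square) has
`Ext¹(𝒪_{X₁}, E|_{X₁}) = 0` and is embedded into `ℙⁿ_K` by finitely many of its own sections of `E|_{X₁}` generating it, then over an
OPEN `U ∋ x` EVERY fibre `X_y` (`y : Spec K′ → T` landing in `U`, `K′` any ring, any cartesian square) is embedded into some `ℙ^m_{K′}`
by finitely many of its own sections of `E|_{X_y}` generating it (read in the frames `F|_{X_y}`).  Chart reduction to the affine core ★
`AmpleLocusOpenAffine.exists_opens_forall_isClosedImmersion_toProj_of_fieldExtension`: an affine open `Spec Γ(T, V) ∋ x` (Noetherian,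
Mathlib `IsLocallyNoetherian.component_noetherian`), the point `x_K` read through `κ(𝔭)` (Mathlib `Ideal.ResidueField.lift`), fibres
moved along cartesian squares (pasting), the embedding read in any model of `E|` (★ `ofCocycleSections_ofFrameSystem_eq_of_iso`,
Hartshorne II Thm. 7.1).

## References
* [EGAIII1] A. Grothendieck, J. Dieudonné, *EGA III₁*, Publ. Math. IHÉS 11 (1961), Thm. (4.7.1) (p. 145), Prop. (4.6.7) (ii).
* [GortzWedhorn2023] U. Görtz, T. Wedhorn, *Algebraic Geometry II* (2023), Thm. 24.46 (p. 397), Cor. 22.91.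
* [MumfordAV1970] D. Mumford, *Abelian Varieties* (1970), §5 Cor. 3 (p. 53).
* [Hartshorne1977] R. Hartshorne, *Algebraic Geometry* (1977), II Thm. 7.1, III Thm. 12.11 (p. 290).
* [StacksProject] The Stacks Project, Tags 0D2N, 0D2S (the statement), 02L6 (descent of closed immersions).
-/

noncomputable section

-- `TopCat.Presheaf`/`Scheme.Modules` and pull-back bookkeeping (as in ★ `Morphisms/ProjectiveOfFibreEmbedding`).
set_option backward.isDefEq.respectTransparency false

open CategoryTheory CategoryTheory.Limits CategoryTheory.Abelian AlgebraicGeometry TopologicalSpace Opposite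
open Literature.AlgebraicGeometry.Modules
open Literature.AlgebraicGeometry.Motives Literature.AlgebraicGeometry.Motives.GeneratingSections


namespace Literature.AlgebraicGeometry.Morphisms

/-! ## §0 Bookkeeping -/

/-- `Ext`-vanishing transports along an isomorphism of the second argument. [folklore] -/
private theorem subsingleton_ext_of_iso'' {C : Type*} [Category C] [Abelian C] [HasExt.{1} C] (P : C) {Y Y' : C}
    (e : Y ≅ Y') (i : ℕ) (h : Subsingleton (Ext.{1} P Y' i)) : Subsingleton (Ext.{1} P Y i) := by
  refine subsingleton_of_forall_eq 0 fun x => ?_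
  have hx : x = (x.comp (Ext.mk₀ e.hom) (add_zero i)).comp (Ext.mk₀ e.inv) (add_zero i) := by
    rw [Ext.comp_assoc_of_second_deg_zero, Ext.mk₀_comp_mk₀, e.hom_inv_id, Ext.comp_mk₀_id]
  rw [hx, Subsingleton.elim (x.comp (Ext.mk₀ e.hom) (add_zero i)) 0, Ext.zero_comp]

/-- **A field-valued point of `Spec A` centred at `𝔭` factors through `Spec κ(𝔭)`**: `y = Spec(φ) ≫ Spec(A → κ(𝔭))` for a (unique)
`φ : κ(𝔭) → K` (Mathlib `Ideal.ResidueField.lift`: the ring map `A → K` of `y` kills `𝔭` and inverts its complement). [folklore] -/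
private theorem exists_eq_specMap_comp_residueField {A : Type} [CommRing A] {K : Type} [Field K]
    (y : Spec (.of K) ⟶ Spec (.of A)) (𝔭 : PrimeSpectrum A) (hy : y (IsLocalRing.closedPoint K) = 𝔭) :
    ∃ φ : 𝔭.asIdeal.ResidueField →+* K,
      y = Spec.map (CommRingCat.ofHom φ) ≫ Spec.map (CommRingCat.ofHom (algebraMap A 𝔭.asIdeal.ResidueField)) := by
  obtain ⟨ψ, rfl⟩ := Spec.map_surjective y
  have hker : RingHom.ker ψ.hom = 𝔭.asIdeal := by
    rw [← hy]
    change RingHom.ker ψ.hom = Ideal.comap ψ.hom (IsLocalRing.maximalIdeal K)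
    rw [IsLocalRing.isField_iff_maximalIdeal_eq.mp (Field.toIsField K), RingHom.ker_eq_comap_bot]
  have hunit : 𝔭.asIdeal.primeCompl ≤ (IsUnit.submonoid K).comap ψ.hom := fun a ha ↦ by
    change IsUnit (ψ.hom a)
    refine isUnit_iff_ne_zero.mpr fun h0 ↦ ha ?_
    rw [← hker]
    exact h0
  refine ⟨Ideal.ResidueField.lift 𝔭.asIdeal ψ.hom hker.ge hunit, ?_⟩
  rw [← Spec.map_comp, ← CommRingCat.ofHom_comp]
  congr 1
  ext a
  change ψ.hom a = Ideal.ResidueField.lift 𝔭.asIdeal ψ.hom hker.ge hunit (algebraMap A 𝔭.asIdeal.ResidueField a)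
  rw [Ideal.ResidueField.lift_algebraMap]


/-! ## §2 Locally Noetherian base: every fibre over a neighbourhood is embedded by its own sections -/

section LocallyNoetherian

variable {T X : Scheme.{0}} [IsLocallyNoetherian T] (f : X ⟶ T) [IsProper f] [Flat f]
  {E : X.Modules} (F : FrameSystem E) (h1 : ∀ x, F.rank x = 1) (x : T)
  {K : Type} [Field K] (xK : Spec (.of K) ⟶ T) (hx : x ∈ Set.range xK)
  {X₁ : Scheme.{0}} {i₁ : X₁ ⟶ X} {f₁ : X₁ ⟶ Spec (.of K)} (H₁ : IsPullback i₁ f₁ f xK)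
  (hvan : Subsingleton (Ext.{1} (unitModule X₁) ((Scheme.Modules.pullback i₁).obj E) 1))
  (h1₁ : ∀ x, (F.pullback i₁).rank x = 1) {n : ℕ} (s : Fin (n + 1) → Γ((Scheme.Modules.pullback i₁).obj E, ⊤))
  (hcov : ⨆ i, ⨆ x, X₁.basicOpen ((CocycleSections.ofFrameSystem (F.pullback i₁) h1₁ s).coeff i x) = ⊤)
  (H : IsClosedImmersion ((ofCocycleSections (F.pullback i₁).U
    (CocycleSections.ofFrameSystem (F.pullback i₁) h1₁ s) hcov).toProj f₁))

include hx H₁ hvan H in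
/-- **THE VERY-AMPLE LOCUS IS OPEN** (EGA III 4.7.1 ∕ [GortzWedhorn2023] Thm. 24.46 in the tree's currency, locally Noetherian base).
`T` locally Noetherian, `f : X → T` PROPER and FLAT, `E` an `𝒪_X`-module with a rank-one frame system `F` (a line bundle with chosen
local generators), `x ∈ T`.  IF over ONE field-valued point `x_K : Spec K → T` centred at `x` (e.g. a geometric point) the fibre
`X₁ = X ×_T Spec K` (ANY cartesian square) has `Ext¹(𝒪_{X₁}, E|_{X₁}) = 0` and is embedded into `ℙⁿ_K` by finitely many of its own
sections of `E|_{X₁}` generating it, THEN there is an OPEN `U ∋ x` such that for EVERY ring-valued point `y : Spec K′ → T` landing in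
`U` and ANY cartesian square `X_y = X ×_T Spec K′`, the fibre `X_y` is embedded into some `ℙ^m_{K′}` by finitely many of its own sections
of `E|_{X_y}` generating it (read in the frames `F|_{X_y}`).  Chart reduction to `exists_opens_forall_isClosedImmersion_toProj_of_fieldExtension`:
an affine open `Spec Γ(T, V) ∋ x` (Noetherian, Mathlib `IsLocallyNoetherian.component_noetherian`), the point `x_K` read through
`κ(𝔭)` (`Ideal.ResidueField.lift`), fibres moved along cartesian squares (pasting) and the embedding read in any model of `E|`
(★ `ofCocycleSections_ofFrameSystem_eq_of_iso`, Hartshorne II Thm. 7.1).  Cf. [EGAIII1] Thm. (4.7.1) (p. 145) (proper, no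
flatness, 𝔪-adic spine; here flat + `H¹`).
[cite: EGAIII1, Thm. (4.7.1) p. 145] [cite: GortzWedhorn2023, Thm. 24.46 (p. 397)] [cite: StacksProject, Tag 0D2N]
[cite: MumfordAV1970, §5 Cor. 3 (p. 53)] -/
theorem exists_opens_forall_fibre_isClosedImmersion_toProj :
    ∃ U : T.Opens, x ∈ U ∧
      ∀ (K' : Type) [CommRing K'] (y : Spec (.of K') ⟶ T), Set.range y ⊆ (U : Set _) →
        ∀ {Xy : Scheme.{0}} (iy : Xy ⟶ X) (fy : Xy ⟶ Spec (.of K')), IsPullback iy fy f y →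
          ∃ (m : ℕ) (s' : Fin (m + 1) → Γ((Scheme.Modules.pullback iy).obj E, ⊤))
            (hcov' : ⨆ i, ⨆ z, Xy.basicOpen ((CocycleSections.ofFrameSystem (F.pullback iy) (fun z ↦ h1 (iy.base z))
              s').coeff i z) = ⊤),
            IsClosedImmersion ((ofCocycleSections (F.pullback iy).U (CocycleSections.ofFrameSystem (F.pullback iy)
              (fun z ↦ h1 (iy.base z)) s') hcov').toProj fy) := by
  -- Step 0: an affine Noetherian chart `ιV : Spec Γ(T, V) → T` through `x`
  obtain ⟨_, ⟨V, hV, rfl⟩, hxV, -⟩ := T.isBasis_affineOpens.exists_subset_of_mem_open (Set.mem_univ x) isOpen_univ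
  haveI : IsNoetherianRing Γ(T, V) := IsLocallyNoetherian.component_noetherian ⟨V, hV⟩
  let ιV : Spec Γ(T, V) ⟶ T := hV.fromSpec
  have hrange : Set.range ιV = (V : Set T) := hV.range_fromSpec
  let XV : Scheme.{0} := pullback f ιV
  let jV : XV ⟶ X := pullback.fst f ιV
  let fV : XV ⟶ Spec Γ(T, V) := pullback.snd f ιV
  have HV : IsPullback jV fV f ιV := IsPullback.of_hasPullback f ιV
  haveI : IsProper fV := MorphismProperty.pullback_snd (P := @IsProper) f ιV inferInstance
  haveI : Flat fV := MorphismProperty.pullback_snd (P := @Flat) f ιV inferInstance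
  -- the prime `𝔭` under `x` and the point `x_K` read over the chart, through `κ(𝔭)`
  obtain ⟨𝔭, h𝔭⟩ : x ∈ Set.range ιV := by rw [hrange]; exact hxV
  have hxK : ∀ p, xK p = x := fun p ↦ by
    obtain ⟨q, hq⟩ := hx
    rw [Subsingleton.elim p q, hq]
  have hsub : Set.range xK ⊆ Set.range ιV := by
    rintro _ ⟨p, rfl⟩
    rw [hxK, ← h𝔭]
    exact ⟨𝔭, rfl⟩
  let xK' : Spec (.of K) ⟶ Spec Γ(T, V) := IsOpenImmersion.lift ιV xK hsub
  have hxK' : xK' ≫ ιV = xK := IsOpenImmersion.lift_fac ιV xK hsub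
  have hpt : xK' (IsLocalRing.closedPoint K) = 𝔭 := by
    apply ιV.isOpenEmbedding.injective
    rw [← Scheme.Hom.comp_apply, hxK', hxK, h𝔭]
  obtain ⟨φ, hφ⟩ := exists_eq_specMap_comp_residueField xK' 𝔭 hpt
  -- the fibre `X₁` over the chart
  let i₁' : X₁ ⟶ XV := HV.lift i₁ (f₁ ≫ xK') (by rw [Category.assoc, hxK']; exact H₁.w)
  have hi₁' : i₁' ≫ jV = i₁ := HV.lift_fst _ _ _
  have H₁' : IsPullback i₁' f₁ fV
      (Spec.map (CommRingCat.ofHom φ) ≫ Spec.map (CommRingCat.ofHom (algebraMap Γ(T, V) 𝔭.asIdeal.ResidueField))) := by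
    rw [← hφ]
    exact IsPullback.of_right (by rw [hi₁', hxK']; exact H₁) (HV.lift_snd _ _ _) HV
  -- the module `E|_{X_V}`, its frames, and the fibre data transported to the model `i₁'^* jV^* E ≅ i₁^* E`
  let EV : XV.Modules := (Scheme.Modules.pullback jV).obj E
  let FV : FrameSystem EV := F.pullback jV
  have h1V : ∀ z, FV.rank z = 1 := fun z ↦ h1 (jV.base z)
  let Φ : (Scheme.Modules.pullback i₁').obj EV ≅ (Scheme.Modules.pullback i₁).obj E :=
    (Scheme.Modules.pullbackComp i₁' jV).app E ≪≫ (Scheme.Modules.pullbackCongr hi₁').app E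
  have hvan' : Subsingleton (Ext.{1} (unitModule X₁) ((Scheme.Modules.pullback i₁').obj EV) 1) :=
    subsingleton_ext_of_iso'' (unitModule X₁) Φ 1 hvan
  have h1₁' : ∀ z, (FV.pullback i₁').rank z = 1 := fun z ↦ h1 _
  obtain ⟨hcov₁, e₁⟩ := ofCocycleSections_ofFrameSystem_eq_of_iso Φ.symm (F.pullback i₁) (FV.pullback i₁') h1₁ h1₁' s hcov
  have H' : IsClosedImmersion ((ofCocycleSections (FV.pullback i₁').U (CocycleSections.ofFrameSystem (FV.pullback i₁') h1₁'
      (fun j ↦ Φ.symm.hom.app ⊤ (s j))) hcov₁).toProj f₁) := by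
    rw [← e₁]; exact H
  -- Step 1: the affine-base theorem
  obtain ⟨m, b, U₀, h𝔭U₀, hU₀⟩ := exists_opens_forall_isClosedImmersion_toProj_of_fieldExtension fV FV h1V 𝔭 φ H₁' hvan' h1₁'
    (fun j ↦ Φ.symm.hom.app ⊤ (s j)) hcov₁ H'
  -- Step 2: the open `ιV(U₀) ∋ x` of `T`
  refine ⟨ιV ''ᵁ U₀, ⟨𝔭, h𝔭U₀, h𝔭⟩, fun K' _ y hy Xy iy fy Hy ↦ ?_⟩
  -- lift `y` to the chart; it lands in `U₀`
  have hsub' : Set.range y ⊆ Set.range ιV := fun t ht ↦ by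
    obtain ⟨p, hp, rfl⟩ := hy ht
    exact ⟨p, rfl⟩
  let y' : Spec (.of K') ⟶ Spec Γ(T, V) := IsOpenImmersion.lift ιV y hsub'
  have hy' : y' ≫ ιV = y := IsOpenImmersion.lift_fac ιV y hsub'
  have hyU₀ : Set.range y' ⊆ (U₀ : Set _) := by
    rintro _ ⟨p, rfl⟩
    obtain ⟨q, hq, hq'⟩ := hy ⟨p, rfl⟩
    rw [← hy', Scheme.Hom.comp_apply] at hq'
    rwa [← ιV.isOpenEmbedding.injective hq']
  -- the fibre `X_y` over the chart
  let h : Xy ⟶ XV := HV.lift iy (fy ≫ y') (by rw [Category.assoc, hy']; exact Hy.w)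
  have hh : h ≫ jV = iy := HV.lift_fst _ _ _
  have Hh : IsPullback h fy fV y' := IsPullback.of_right (by rw [hh, hy']; exact Hy) (HV.lift_snd _ _ _) HV
  obtain ⟨hcovy, Hy'⟩ := hU₀ K' y' hyU₀ h fy Hh
  -- Step 3: read the embedding in the model `iy^* E ≅ h^* jV^* E` and the frames `F|_{X_y}`
  let Ψ : (Scheme.Modules.pullback h).obj EV ≅ (Scheme.Modules.pullback iy).obj E :=
    (Scheme.Modules.pullbackComp h jV).app E ≪≫ (Scheme.Modules.pullbackCongr hh).app E
  have h1y : ∀ z, (F.pullback iy).rank z = 1 := fun z ↦ h1 (iy.base z)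
  obtain ⟨hcov', e'⟩ := ofCocycleSections_ofFrameSystem_eq_of_iso Ψ (FV.pullback h) (F.pullback iy) (fun z ↦ h1V (h.base z))
    h1y (fun j ↦ unitSectionLE h EV (V := ⊤) (U := ⊤) le_top (b j)) hcovy
  refine ⟨m, fun j ↦ Ψ.hom.app ⊤ (unitSectionLE h EV (V := ⊤) (U := ⊤) le_top (b j)), hcov', ?_⟩
  rw [← e']
  exact Hy'

end LocallyNoetherian

end Literature.AlgebraicGeometry.Morphisms

end
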